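import Summits.NavierStokesRegularity.NavierStokesRegularity.Theses.AdaptedFrequency
import Summits.NavierStokesRegularity.NavierStokesRegularity.Theorems.AdaptedFrequencyFrequencyRigidityClassicalSuitableSlab
import Summits.NavierStokesRegularity.NavierStokesRegularity.Theorems.AdaptedFrequencyFrequencyRigidityScaledEnergySplitGlue
import Summits.NavierStokesRegularity.NavierStokesRegularity.Theorems.AdaptedFrequencyFrequencyRigidityFrameNormalisation
import Literature.Analysis.FluidPDE.LocalTypeI
import Literature.Analysis.FluidPDE.ClassicalSuitable
import HarnessLib

/-!
# Crux `FrequencyRigidity` (stmt-NavierStokesRegularity-2955), line `scaled-energy-split`: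
# glue for the finite child in Albritton–Barker form (Stub 2′)

Helper file (`--supports stmt-NavierStokesRegularity-2955`; theorems only, sorry-free).

Stub 2 of the line (`stub_finiteScaledEnergyLiouville`) forbids an inhabitant of the crux body — a
classical ancient Navier–Stokes flow `(v, q)` on `ℝ³ × (−∞, 0)` with the global Type-I bound, an
adapted Gaussian-comparable kernel `K` at the pole, positive adapted enstrophy and constant adapted
frequency — whose Albritton–Barker quantity `typeIBound (ℝ₋ × ℝ³) v q ∇v` (computed with the
CLASSICAL pressure `q` and gradient `∇v`) is finite.  Stub 2′
(`stub_finiteScaledEnergyLiouvilleAB`) is the same statement with the Albritton–Barker data made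
EXISTENTIAL: no inhabitant admitting SOME suitable pressure `ϖ` and weak spatial gradient `G'` on
the open slab with `typeIBound (ℝ₋ × ℝ³) v ϖ G' < ⊤` — the form in which the strengthened tangent-flow
transfer (`tangentFlowTransfer_finiteAB`) delivers the tangent flow.

This file records the pure bookkeeping around Stub 2′:

* `finiteAB_classicalSuitableSlab`: a classical solution on the backward slab, at ANY viscosity
  `ν`, is a suitable weak solution there and `∇v` is a weak spatial gradient (CKN 1982 §2; the tree's
  `stub_classicalSuitableSlab` is the case `ν = 1`);
* `finiteAB_stub2_of_stub2AB` (registered): Stub 2′ ⇒ Stub 2 (take `ϖ := q`, `G' := ∇v`);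
* `finiteAB_stub2AB_of_frequencyRigidity` (registered): the crux ⇒ Stub 2′ (weakening);
* `finiteAB_closes`: the route's deciding chain with `FrequencyRigidity` replaced by Stub 2′ and
  `TangentFlowTransfer` by its Albritton–Barker strengthening — the route closes from the finite
  child alone;
* `frequencyRigidity_of_stub2AB_of_stub3`: Stub 2′ and Stub 3 give the crux (via the landed exact
  split `stub_scaledEnergySplitGlue` and the Galilean gauge fixing `stub_frameNormalisation`).

## References

* L. Caffarelli, R. Kohn, L. Nirenberg, *Partial regularity of suitable weak solutions of the
  Navier–Stokes equations*, Comm. Pure Appl. Math. 35 (1982), §2, (2.1)–(2.5).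
  [CaffarelliKohnNirenberg1982]
* D. Albritton, T. Barker, J. Math. Fluid Mech. 21 (2019), §1 (the quantity `𝐈`).
  [AlbrittonBarker2019]
-/

noncomputable section

set_option linter.dupNamespace false

namespace Summit.NavierStokesRegularity.NavierStokesRegularity.Theorems

open Literature.Analysis.FluidPDE MeasureTheory Set Function
open scoped Laplacian

/-- **Classical solutions on the backward slab are suitable weak solutions, with weak spatial
gradient the classical one, at any viscosity `ν`**: if `(u, p)` is a classical solution of
Navier–Stokes (viscosity `ν`, `f = 0`) on the time set `(−∞, 0)`, then `(u, p)` is a suitable weak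
solution on the open slab `(−∞, 0) × ℝ³` and `(t, x) ↦ fderiv ℝ (u t) x` is a weak spatial gradient
of `u` there (CKN 1982, §2: for smooth solutions (2.1)–(2.4) hold and (2.5) holds with equality; tree
`isSuitableWeakSolutionOn_of_contDiffOn`, `hasWeakSpatialGradientOn_of_contDiffOn`; the viscosity-`1`
case is the tree's `stub_classicalSuitableSlab`). [cite: CaffarelliKohnNirenberg1982, §2 (2.1)–(2.5)] -/
theorem finiteAB_classicalSuitableSlab (ν : ℝ)
    (u : ℝ → EuclideanSpace ℝ (Fin 3) → EuclideanSpace ℝ (Fin 3)) (p : ℝ → EuclideanSpace ℝ (Fin 3) → ℝ)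
    (h : Literature.Analysis.FluidPDE.IsClassicalNSSolutionOn (Set.Iio 0) ν 0 u p) :
    Literature.Analysis.FluidPDE.IsSuitableWeakSolutionOn
        (Literature.Analysis.FluidPDE.slab (EuclideanSpace ℝ (Fin 3)) (Set.Iio 0) isOpen_Iio) ν 0 u p ∧
      Literature.Analysis.FluidPDE.HasWeakSpatialGradientOn
        (Literature.Analysis.FluidPDE.slab (EuclideanSpace ℝ (Fin 3)) (Set.Iio 0) isOpen_Iio) u
        (fun t x => fderiv ℝ (u t) x) := by
  -- adapted from `stub_classicalSuitableSlab` (ν = 1), verbatim with `1 ↦ ν`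
  have hQ : ((slab (EuclideanSpace ℝ (Fin 3)) (Iio 0) isOpen_Iio :
      TopologicalSpace.Opens (ℝ × EuclideanSpace ℝ (Fin 3))) : Set (ℝ × EuclideanSpace ℝ (Fin 3))) ⊆
        Iio 0 ×ˢ univ := by
    rw [coe_slab]
  have hu2 : ContDiffOn ℝ 2 (uncurry u) (Iio 0 ×ˢ univ) := h.smooth_velocity.of_le (by norm_cast)
  have hu1 : ContDiffOn ℝ 1 (uncurry u) (Iio 0 ×ˢ univ) := h.smooth_velocity.of_le (by norm_cast)
  have hp1 : ContDiffOn ℝ 1 (uncurry p) (Iio 0 ×ˢ univ) := h.smooth_pressure.of_le (by norm_cast)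
  exact ⟨isSuitableWeakSolutionOn_of_contDiffOn isOpen_Iio hQ hu2 hp1 continuousOn_const
      (FrequencyRigidity.ScaledEnergySplit.classicalSlab_momentum_timeDeriv isOpen_Iio h) h.divFree,
    hasWeakSpatialGradientOn_of_contDiffOn isOpen_Iio hQ hu1⟩

/-- **Stub 2′ ⇒ Stub 2** (registered sub-goal `finiteAB_stub2_of_stub2AB` of line
`scaled-energy-split`): every inhabitant of the crux body with finite Albritton–Barker quantity for
the classical pressure `q` and gradient `∇v` is an inhabitant in the Albritton–Barker form, with
`ϖ := q` and `G' := fun t x => fderiv ℝ (v t) x`, because a classical solution on the backward slab is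
a suitable weak solution there with that weak gradient, at the witness's viscosity `ν`
(`finiteAB_classicalSuitableSlab`). [cite: CaffarelliKohnNirenberg1982, §2 (2.1)–(2.5)] -/
theorem finiteAB_stub2_of_stub2AB : (¬ ∃ (ν C Λ₀ : ℝ) (v : ℝ → EuclideanSpace ℝ (Fin 3) → EuclideanSpace ℝ (Fin 3)) (q : ℝ → EuclideanSpace ℝ (Fin 3) → ℝ) (K : ℝ → EuclideanSpace ℝ (Fin 3) → ℝ), (0 < ν ∧ Literature.Analysis.FluidPDE.IsClassicalNSSolutionOn (Set.Iio 0) ν 0 v q ∧ (∀ t ∈ Set.Iio (0:ℝ), ∀ x, ‖v t x‖ ≤ C / Real.sqrt (-t)) ∧ ContDiffOn ℝ 2 (Function.uncurry K) (Set.Iio (0:ℝ) ×ˢ Set.univ) ∧ (∀ t ∈ Set.Iio (0:ℝ), ∀ x, 0 < K t x) ∧ (∀ t ∈ Set.Iio (0:ℝ), ∀ x, Literature.Analysis.FluidPDE.timeDerivWithin (Set.Iio (0:ℝ)) K t x + fderiv ℝ (K t) x (v t x) + ν * Laplacian.laplacian (K t) x = 0) ∧ (∀ t ∈ Set.Iio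 (0:ℝ), ∫ x, K t x = 1) ∧ (∀ φ : EuclideanSpace ℝ (Fin 3) → ℝ, Continuous φ → (∃ M : ℝ, ∀ x, |φ x| ≤ M) → Filter.Tendsto (fun t => ∫ x, φ x * K t x) (nhdsWithin (0:ℝ) (Set.Iio (0:ℝ))) (nhds (φ (0 : EuclideanSpace ℝ (Fin 3))))) ∧ (∃ c₁ c₂ C₁ C₂ : ℝ, 0 < c₁ ∧ 0 < c₂ ∧ 0 < C₁ ∧ 0 < C₂ ∧ ∀ t ∈ Set.Iio (0:ℝ), ∀ x, c₁ * ((0:ℝ) - t) ^ (-(3:ℝ) / 2) * Real.exp (-(‖x - (0 : EuclideanSpace ℝ (Fin 3))‖ ^ 2) / (c₂ * ((0:ℝ) - t))) ≤ K t x ∧ K t x ≤ C₁ * ((0:ℝ) - t) ^ (-(3:ℝ) / 2) * Real.exp (-(‖x - (0 : EuclideanSpace ℝ (Fin 3))‖ ^ 2) / (C₂ * ((0:ℝ) - t)))) ∧ (∀ H Λ : ℝ → ℝ, H = (fun t => ∫ x, ‖Literature.Analysis.FluidPDE.curl (v t) x‖ ^ 2 * K t x) → Λ = (fun t => (0 -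 t) * deriv H t / H t) → (∀ t ∈ Set.Iio (0:ℝ), 0 < H t) ∧ (∀ t ∈ Set.Iio (0:ℝ), Λ t = Λ₀))) ∧ (∃ (ϖ : ℝ → EuclideanSpace ℝ (Fin 3) → ℝ) (G' : ℝ → EuclideanSpace ℝ (Fin 3) → EuclideanSpace ℝ (Fin 3) →L[ℝ] EuclideanSpace ℝ (Fin 3)), Literature.Analysis.FluidPDE.IsSuitableWeakSolutionOn (Literature.Analysis.FluidPDE.slab (EuclideanSpace ℝ (Fin 3)) (Set.Iio 0) isOpen_Iio) ν 0 v ϖ ∧ Literature.Analysis.FluidPDE.HasWeakSpatialGradientOn (Literature.Analysis.FluidPDE.slab (EuclideanSpace ℝ (Fin 3)) (Set.Iio 0) isOpen_Iio) v G' ∧ Literature.Analysis.FluidPDE.typeIBound (Set.Iio (0:ℝ) ×ˢ Set.univ) v ϖ G' < ⊤)) → (¬ ∃ (ν C Λ₀ : ℝ) (v : ℝ → EuclideanSpace ℝ (Fin 3) → EuclideanSpace ℝ (Fin 3)) (q : ℝ → EuclideanSpace ℝ (Fin 3) → ℝ) (K : ℝ → EuclideanSpace ℝ (Fin 3) → ℝ),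 (0 < ν ∧ Literature.Analysis.FluidPDE.IsClassicalNSSolutionOn (Set.Iio 0) ν 0 v q ∧ (∀ t ∈ Set.Iio (0:ℝ), ∀ x, ‖v t x‖ ≤ C / Real.sqrt (-t)) ∧ ContDiffOn ℝ 2 (Function.uncurry K) (Set.Iio (0:ℝ) ×ˢ Set.univ) ∧ (∀ t ∈ Set.Iio (0:ℝ), ∀ x, 0 < K t x) ∧ (∀ t ∈ Set.Iio (0:ℝ), ∀ x, Literature.Analysis.FluidPDE.timeDerivWithin (Set.Iio (0:ℝ)) K t x + fderiv ℝ (K t) x (v t x) + ν * Laplacian.laplacian (K t) x = 0) ∧ (∀ t ∈ Set.Iio (0:ℝ), ∫ x, K t x = 1) ∧ (∀ φ : EuclideanSpace ℝ (Fin 3) → ℝ, Continuous φ → (∃ M : ℝ, ∀ x, |φ x| ≤ M) → Filter.Tendsto (fun t => ∫ x, φ x * K t x) (nhdsWithin (0:ℝ) (Set.Iio (0:ℝ))) (nhds (φ (0 : EuclideanSpace ℝ (Fin 3))))) ∧ (∃ c₁ c₂ C₁ C₂ : ℝ, 0 < c₁ ∧ 0 < c₂ ∧ 0 < C₁ ∧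 0 < C₂ ∧ ∀ t ∈ Set.Iio (0:ℝ), ∀ x, c₁ * ((0:ℝ) - t) ^ (-(3:ℝ) / 2) * Real.exp (-(‖x - (0 : EuclideanSpace ℝ (Fin 3))‖ ^ 2) / (c₂ * ((0:ℝ) - t))) ≤ K t x ∧ K t x ≤ C₁ * ((0:ℝ) - t) ^ (-(3:ℝ) / 2) * Real.exp (-(‖x - (0 : EuclideanSpace ℝ (Fin 3))‖ ^ 2) / (C₂ * ((0:ℝ) - t)))) ∧ (∀ H Λ : ℝ → ℝ, H = (fun t => ∫ x, ‖Literature.Analysis.FluidPDE.curl (v t) x‖ ^ 2 * K t x) → Λ = (fun t => (0 - t) * deriv H t / H t) → (∀ t ∈ Set.Iio (0:ℝ), 0 < H t) ∧ (∀ t ∈ Set.Iio (0:ℝ), Λ t = Λ₀))) ∧ Literature.Analysis.FluidPDE.typeIBound (Set.Iio (0:ℝ) ×ˢ Set.univ) v q (fun t x => fderiv ℝ (v t) x) < ⊤) := by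
  intro h2'
  rintro ⟨ν, C, Λ₀, v, q, K, hbody, hI⟩
  obtain ⟨hsw, hwg⟩ := finiteAB_classicalSuitableSlab ν v q hbody.2.1
  exact h2' ⟨ν, C, Λ₀, v, q, K, hbody, q, fun t x => fderiv ℝ (v t) x, hsw, hwg, hI⟩

/-- **The crux ⇒ Stub 2′** (registered sub-goal `finiteAB_stub2AB_of_frequencyRigidity` of line
`scaled-energy-split`): `FrequencyRigidity` forbids every inhabitant of the crux body, in particular
those in the Albritton–Barker class (weakening: drop the `∃ ϖ G'` conjunct). -/
theorem finiteAB_stub2AB_of_frequencyRigidity : Summit.NavierStokesRegularity.NavierStokesRegularity.Theses.AdaptedFrequency.FrequencyRigidity → (¬ ∃ (ν C Λ₀ : ℝ) (v : ℝ → EuclideanSpace ℝ (Fin 3) → EuclideanSpace ℝ (Fin 3)) (q : ℝ → EuclideanSpace ℝ (Fin 3) → ℝ) (K : ℝ → EuclideanSpace ℝ (Fin 3) → ℝ), (0 < ν ∧ Literature.Analysis.FluidPDE.IsClassicalNSSolutionOn (Set.Iio 0) ν 0 v q ∧ (∀ t ∈ Set.Iio (0:ℝ), ∀ x, ‖v t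 x‖ ≤ C / Real.sqrt (-t)) ∧ ContDiffOn ℝ 2 (Function.uncurry K) (Set.Iio (0:ℝ) ×ˢ Set.univ) ∧ (∀ t ∈ Set.Iio (0:ℝ), ∀ x, 0 < K t x) ∧ (∀ t ∈ Set.Iio (0:ℝ), ∀ x, Literature.Analysis.FluidPDE.timeDerivWithin (Set.Iio (0:ℝ)) K t x + fderiv ℝ (K t) x (v t x) + ν * Laplacian.laplacian (K t) x = 0) ∧ (∀ t ∈ Set.Iio (0:ℝ), ∫ x, K t x = 1) ∧ (∀ φ : EuclideanSpace ℝ (Fin 3) → ℝ, Continuous φ → (∃ M : ℝ, ∀ x, |φ x| ≤ M) → Filter.Tendsto (fun t => ∫ x, φ x * K t x) (nhdsWithin (0:ℝ) (Set.Iio (0:ℝ))) (nhds (φ (0 : EuclideanSpace ℝ (Fin 3))))) ∧ (∃ c₁ c₂ C₁ C₂ : ℝ, 0 < c₁ ∧ 0 < c₂ ∧ 0 < C₁ ∧ 0 < C₂ ∧ ∀ t ∈ Set.Iio (0:ℝ), ∀ x, c₁ * ((0:ℝ) - t) ^ (-(3:ℝ) / 2) * Real.exp (-(‖x - (0 : EuclideanSpace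 ℝ (Fin 3))‖ ^ 2) / (c₂ * ((0:ℝ) - t))) ≤ K t x ∧ K t x ≤ C₁ * ((0:ℝ) - t) ^ (-(3:ℝ) / 2) * Real.exp (-(‖x - (0 : EuclideanSpace ℝ (Fin 3))‖ ^ 2) / (C₂ * ((0:ℝ) - t)))) ∧ (∀ H Λ : ℝ → ℝ, H = (fun t => ∫ x, ‖Literature.Analysis.FluidPDE.curl (v t) x‖ ^ 2 * K t x) → Λ = (fun t => (0 - t) * deriv H t / H t) → (∀ t ∈ Set.Iio (0:ℝ), 0 < H t) ∧ (∀ t ∈ Set.Iio (0:ℝ), Λ t = Λ₀))) ∧ (∃ (ϖ : ℝ → EuclideanSpace ℝ (Fin 3) → ℝ) (G' : ℝ → EuclideanSpace ℝ (Fin 3) → EuclideanSpace ℝ (Fin 3) →L[ℝ] EuclideanSpace ℝ (Fin 3)), Literature.Analysis.FluidPDE.IsSuitableWeakSolutionOn (Literature.Analysis.FluidPDE.slab (EuclideanSpace ℝ (Fin 3)) (Set.Iio 0) isOpen_Iio) ν 0 v ϖ ∧ Literature.Analysis.FluidPDE.HasWeakSpatialGradientOn (Literature.Analysis.FluidPDE.slab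 (EuclideanSpace ℝ (Fin 3)) (Set.Iio 0) isOpen_Iio) v G' ∧ Literature.Analysis.FluidPDE.typeIBound (Set.Iio (0:ℝ) ×ˢ Set.univ) v ϖ G' < ⊤)) := by
  intro hFR
  unfold Summit.NavierStokesRegularity.NavierStokesRegularity.Theses.AdaptedFrequency.FrequencyRigidity at hFR
  rintro ⟨ν, C, Λ₀, v, q, K, hbody, _⟩
  exact hFR ⟨ν, C, Λ₀, v, q, K, hbody⟩

/-- **The route closes from the finite child in Albritton–Barker form.**  The deciding chain of route
`AdaptedFrequency` (`Theses.AdaptedFrequency.closes`) with `FrequencyRigidity` replaced by Stub 2′ and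
`TangentFlowTransfer` replaced by its Albritton–Barker strengthening (the tangent flow comes WITH a
suitable pressure `ϖ` and a weak gradient `G'` on the slab, `typeIBound < ⊤`): a putative
non-extendable Clay solution is maximal, hence Type I (`NoTypeII`), has a backward-singular point
(`SingularPointExists`), an adapted comparable kernel there (`AdaptedKernelExists`), a convergent
adapted frequency (`AdaptedFrequencyConverges`), and the strengthened transfer produces an inhabitant
of Stub 2′'s class — contradiction; `NoBlowupToClay` converts. Pure logic. -/
theorem finiteAB_closes : Summit.NavierStokesRegularity.NavierStokesRegularity.Theses.AdaptedFrequency.AdaptedFrequencyConverges → (¬ ∃ (ν C Λ₀ : ℝ) (v : ℝ → EuclideanSpace ℝ (Fin 3) → EuclideanSpace ℝ (Fin 3)) (q : ℝ → EuclideanSpace ℝ (Fin 3) → ℝ) (K : ℝ → EuclideanSpace ℝ (Fin 3) → ℝ), (0 < ν ∧ Literature.Analysis.FluidPDE.IsClassicalNSSolutionOn (Set.Iio 0) ν 0 v q ∧ (∀ t ∈ Set.Iio (0:ℝ), ∀ x, ‖v t x‖ ≤ C / Real.sqrt (-t)) ∧ ContDiffOn ℝ 2 (Function.uncurry K) (Set.Iio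 (0:ℝ) ×ˢ Set.univ) ∧ (∀ t ∈ Set.Iio (0:ℝ), ∀ x, 0 < K t x) ∧ (∀ t ∈ Set.Iio (0:ℝ), ∀ x, Literature.Analysis.FluidPDE.timeDerivWithin (Set.Iio (0:ℝ)) K t x + fderiv ℝ (K t) x (v t x) + ν * Laplacian.laplacian (K t) x = 0) ∧ (∀ t ∈ Set.Iio (0:ℝ), ∫ x, K t x = 1) ∧ (∀ φ : EuclideanSpace ℝ (Fin 3) → ℝ, Continuous φ → (∃ M : ℝ, ∀ x, |φ x| ≤ M) → Filter.Tendsto (fun t => ∫ x, φ x * K t x) (nhdsWithin (0:ℝ) (Set.Iio (0:ℝ))) (nhds (φ (0 : EuclideanSpace ℝ (Fin 3))))) ∧ (∃ c₁ c₂ C₁ C₂ : ℝ, 0 < c₁ ∧ 0 < c₂ ∧ 0 < C₁ ∧ 0 < C₂ ∧ ∀ t ∈ Set.Iio (0:ℝ), ∀ x, c₁ * ((0:ℝ) - t) ^ (-(3:ℝ) / 2) * Real.exp (-(‖x - (0 : EuclideanSpace ℝ (Fin 3))‖ ^ 2) / (c₂ * ((0:ℝ) - t))) ≤ K t x ∧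 K t x ≤ C₁ * ((0:ℝ) - t) ^ (-(3:ℝ) / 2) * Real.exp (-(‖x - (0 : EuclideanSpace ℝ (Fin 3))‖ ^ 2) / (C₂ * ((0:ℝ) - t)))) ∧ (∀ H Λ : ℝ → ℝ, H = (fun t => ∫ x, ‖Literature.Analysis.FluidPDE.curl (v t) x‖ ^ 2 * K t x) → Λ = (fun t => (0 - t) * deriv H t / H t) → (∀ t ∈ Set.Iio (0:ℝ), 0 < H t) ∧ (∀ t ∈ Set.Iio (0:ℝ), Λ t = Λ₀))) ∧ (∃ (ϖ : ℝ → EuclideanSpace ℝ (Fin 3) → ℝ) (G' : ℝ → EuclideanSpace ℝ (Fin 3) → EuclideanSpace ℝ (Fin 3) →L[ℝ] EuclideanSpace ℝ (Fin 3)), Literature.Analysis.FluidPDE.IsSuitableWeakSolutionOn (Literature.Analysis.FluidPDE.slab (EuclideanSpace ℝ (Fin 3)) (Set.Iio 0) isOpen_Iio) ν 0 v ϖ ∧ Literature.Analysis.FluidPDE.HasWeakSpatialGradientOn (Literature.Analysis.FluidPDE.slab (EuclideanSpace ℝ (Fin 3)) (Set.Iio 0) isOpen_Iio) v G' ∧ Literature.Analysis.FluidPDE.typeIBound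 (Set.Iio (0:ℝ) ×ˢ Set.univ) v ϖ G' < ⊤)) → (∀ (ν T : ℝ), 0 < ν → 0 < T → ∀ (u : ℝ → EuclideanSpace ℝ (Fin 3) → EuclideanSpace ℝ (Fin 3)) (p : ℝ → EuclideanSpace ℝ (Fin 3) → ℝ), Literature.Analysis.FluidPDE.IsClassicalNSSolutionOn (Set.Ico 0 T) ν 0 u p → Literature.Analysis.FluidPDE.IsLerayHopfOn T ν 0 (u 0) u → Literature.Analysis.FluidPDE.HasRapidSpatialDecay (u 0) → Literature.Analysis.FluidPDE.IsTypeIBlowup u T → ∀ (x₀ : EuclideanSpace ℝ (Fin 3)) (t₀ : ℝ) (G : ℝ → EuclideanSpace ℝ (Fin 3) → ℝ), t₀ ∈ Set.Ico 0 T → (∀ r : ℝ, 0 < r → MeasureTheory.eLpNorm (Function.uncurry u) ⊤ (MeasureTheory.Measure.restrict MeasureTheory.volume (Literature.Analysis.FluidPDE.parabolicCylinder r (T, x₀))) = ⊤) → ContDiffOn ℝ 2 (Function.uncurry G) (Set.Ico t₀ T ×ˢ Set.univ) ∧ (∀ t ∈ Set.Ico t₀ T, ∀ x, 0 < G t x)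 ∧ (∀ t ∈ Set.Ico t₀ T, ∀ x, Literature.Analysis.FluidPDE.timeDerivWithin (Set.Ico t₀ T) G t x + fderiv ℝ (G t) x (u t x) + ν * Laplacian.laplacian (G t) x = 0) ∧ (∀ t ∈ Set.Ico t₀ T, ∫ x, G t x = 1) ∧ (∀ φ : EuclideanSpace ℝ (Fin 3) → ℝ, Continuous φ → (∃ M : ℝ, ∀ x, |φ x| ≤ M) → Filter.Tendsto (fun t => ∫ x, φ x * G t x) (nhdsWithin T (Set.Iio T)) (nhds (φ x₀))) → (∃ c₁ c₂ C₁ C₂ : ℝ, 0 < c₁ ∧ 0 < c₂ ∧ 0 < C₁ ∧ 0 < C₂ ∧ ∀ t ∈ Set.Ico t₀ T, ∀ x, c₁ * (T - t) ^ (-(3:ℝ) / 2) * Real.exp (-(‖x - x₀‖ ^ 2) / (c₂ * (T - t))) ≤ G t x ∧ G t x ≤ C₁ * (T - t) ^ (-(3:ℝ) / 2) * Real.exp (-(‖x - x₀‖ ^ 2) / (C₂ * (T - t)))) → ∀ H Λ : ℝ → ℝ, H = (fun t => ∫ x, ‖Literature.Analysis.FluidPDE.curl (u t) x‖ ^ 2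 * G t x) → Λ = (fun t => (T - t) * deriv H t / H t) → ∀ Λ₀ : ℝ, Filter.Tendsto Λ (nhdsWithin T (Set.Iio T)) (nhds Λ₀) → ∃ (C : ℝ) (v : ℝ → EuclideanSpace ℝ (Fin 3) → EuclideanSpace ℝ (Fin 3)) (q : ℝ → EuclideanSpace ℝ (Fin 3) → ℝ) (K : ℝ → EuclideanSpace ℝ (Fin 3) → ℝ), (Literature.Analysis.FluidPDE.IsClassicalNSSolutionOn (Set.Iio 0) ν 0 v q ∧ (∀ t ∈ Set.Iio (0:ℝ), ∀ x, ‖v t x‖ ≤ C / Real.sqrt (-t)) ∧ ContDiffOn ℝ 2 (Function.uncurry K) (Set.Iio (0:ℝ) ×ˢ Set.univ) ∧ (∀ t ∈ Set.Iio (0:ℝ), ∀ x, 0 < K t x) ∧ (∀ t ∈ Set.Iio (0:ℝ), ∀ x, Literature.Analysis.FluidPDE.timeDerivWithin (Set.Iio (0:ℝ)) K t x + fderiv ℝ (K t) x (v t x) + ν * Laplacian.laplacian (K t) x = 0) ∧ (∀ t ∈ Set.Iio (0:ℝ), ∫ x, K t x = 1) ∧ (∀ φ : EuclideanSpace ℝ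 (Fin 3) → ℝ, Continuous φ → (∃ M : ℝ, ∀ x, |φ x| ≤ M) → Filter.Tendsto (fun t => ∫ x, φ x * K t x) (nhdsWithin (0:ℝ) (Set.Iio (0:ℝ))) (nhds (φ (0 : EuclideanSpace ℝ (Fin 3))))) ∧ (∃ c₁ c₂ C₁ C₂ : ℝ, 0 < c₁ ∧ 0 < c₂ ∧ 0 < C₁ ∧ 0 < C₂ ∧ ∀ t ∈ Set.Iio (0:ℝ), ∀ x, c₁ * ((0:ℝ) - t) ^ (-(3:ℝ) / 2) * Real.exp (-(‖x - (0 : EuclideanSpace ℝ (Fin 3))‖ ^ 2) / (c₂ * ((0:ℝ) - t))) ≤ K t x ∧ K t x ≤ C₁ * ((0:ℝ) - t) ^ (-(3:ℝ) / 2) * Real.exp (-(‖x - (0 : EuclideanSpace ℝ (Fin 3))‖ ^ 2) / (C₂ * ((0:ℝ) - t)))) ∧ (∀ H Λ : ℝ → ℝ, H = (fun t => ∫ x, ‖Literature.Analysis.FluidPDE.curl (v t) x‖ ^ 2 * K t x) → Λ = (fun t => (0 - t) * deriv H t / H t) → (∀ t ∈ Set.Iio (0:ℝ), 0 < H t) ∧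 (∀ t ∈ Set.Iio (0:ℝ), Λ t = Λ₀))) ∧ (∃ (ϖ : ℝ → EuclideanSpace ℝ (Fin 3) → ℝ) (G' : ℝ → EuclideanSpace ℝ (Fin 3) → EuclideanSpace ℝ (Fin 3) →L[ℝ] EuclideanSpace ℝ (Fin 3)), Literature.Analysis.FluidPDE.IsSuitableWeakSolutionOn (Literature.Analysis.FluidPDE.slab (EuclideanSpace ℝ (Fin 3)) (Set.Iio 0) isOpen_Iio) ν 0 v ϖ ∧ Literature.Analysis.FluidPDE.HasWeakSpatialGradientOn (Literature.Analysis.FluidPDE.slab (EuclideanSpace ℝ (Fin 3)) (Set.Iio 0) isOpen_Iio) v G' ∧ Literature.Analysis.FluidPDE.typeIBound (Set.Iio (0:ℝ) ×ˢ Set.univ) v ϖ G' < ⊤)) → Summit.NavierStokesRegularity.NavierStokesRegularity.Theses.AdaptedFrequency.AdaptedKernelExists → Summit.NavierStokesRegularity.NavierStokesRegularity.Theses.AdaptedFrequency.SingularPointExists → Summit.NavierStokesRegularity.NavierStokesRegularity.Theses.AdaptedFrequency.NoTypeII → Summit.NavierStokesRegularity.NavierStokesRegularity.Theses.AdaptedFrequency.NoBlowupToClay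 → NavierStokesRegularity := by
  -- adapted from `Theses.AdaptedFrequency.closes` (the route's deciding theorem)
  intro hAFC hFR hTFT hAKE hSPE hNT2 hNBC
  refine hNBC ?_
  intro ν T hν hT u p hcl hLH hdec
  by_contra hne
  have hmax : Literature.Analysis.FluidPDE.IsMaximalSmoothSolution ν 0 u p T := ⟨hcl, hne⟩
  have hTI : Literature.Analysis.FluidPDE.IsTypeIBlowup u T := hNT2 ν T hν hT u p hmax hLH hdec
  obtain ⟨x₀, hsing⟩ := hSPE ν T hν hT u p hmax hLH hdec
  obtain ⟨t₀, ht₀, G, hK, hcomp⟩ := hAKE ν T hν hT u p hcl hLH hdec hTI x₀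
  obtain ⟨Λ₀, hlim⟩ := hAFC ν T hν hT u p hcl hLH hdec hTI x₀ t₀ G ht₀ hsing hK hcomp _ _ rfl rfl
  obtain ⟨C, v, q, K, hbody, hAB⟩ :=
    hTFT ν T hν hT u p hcl hLH hdec hTI x₀ t₀ G ht₀ hsing hK hcomp _ _ rfl rfl Λ₀ hlim
  exact hFR ⟨ν, C, Λ₀, v, q, K, ⟨hν, hbody⟩, hAB⟩

/-- **Stub 2′ and Stub 3 give the crux.**  Composition over the landed pieces of the line: Stub 2′ ⇒
Stub 2 (`finiteAB_stub2_of_stub2AB`) ⇒ the frame-invariant finite child (Galilean gauge fixing,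
`stub_frameNormalisation`), and the crux is EQUIVALENT to (finite child) ∧ (Stub 3) by the exact split
`stub_scaledEnergySplitGlue` (excluded middle on the frame predicate). Pure logic. -/
theorem frequencyRigidity_of_stub2AB_of_stub3 : (¬ ∃ (ν C Λ₀ : ℝ) (v : ℝ → EuclideanSpace ℝ (Fin 3) → EuclideanSpace ℝ (Fin 3)) (q : ℝ → EuclideanSpace ℝ (Fin 3) → ℝ) (K : ℝ → EuclideanSpace ℝ (Fin 3) → ℝ), (0 < ν ∧ Literature.Analysis.FluidPDE.IsClassicalNSSolutionOn (Set.Iio 0) ν 0 v q ∧ (∀ t ∈ Set.Iio (0:ℝ), ∀ x, ‖v t x‖ ≤ C / Real.sqrt (-t)) ∧ ContDiffOn ℝ 2 (Function.uncurry K) (Set.Iio (0:ℝ) ×ˢ Set.univ) ∧ (∀ t ∈ Set.Iio (0:ℝ), ∀ x, 0 < K t x) ∧ (∀ t ∈ Set.Iio (0:ℝ), ∀ x, Literature.Analysis.FluidPDE.timeDerivWithin (Set.Iio (0:ℝ)) K t x + fderiv ℝ (K t) x (v t x) + ν * Laplacian.laplacian (K t) x = 0) ∧ (∀ t ∈ Set.Iio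 (0:ℝ), ∫ x, K t x = 1) ∧ (∀ φ : EuclideanSpace ℝ (Fin 3) → ℝ, Continuous φ → (∃ M : ℝ, ∀ x, |φ x| ≤ M) → Filter.Tendsto (fun t => ∫ x, φ x * K t x) (nhdsWithin (0:ℝ) (Set.Iio (0:ℝ))) (nhds (φ (0 : EuclideanSpace ℝ (Fin 3))))) ∧ (∃ c₁ c₂ C₁ C₂ : ℝ, 0 < c₁ ∧ 0 < c₂ ∧ 0 < C₁ ∧ 0 < C₂ ∧ ∀ t ∈ Set.Iio (0:ℝ), ∀ x, c₁ * ((0:ℝ) - t) ^ (-(3:ℝ) / 2) * Real.exp (-(‖x - (0 : EuclideanSpace ℝ (Fin 3))‖ ^ 2) / (c₂ * ((0:ℝ) - t))) ≤ K t x ∧ K t x ≤ C₁ * ((0:ℝ) - t) ^ (-(3:ℝ) / 2) * Real.exp (-(‖x - (0 : EuclideanSpace ℝ (Fin 3))‖ ^ 2) / (C₂ * ((0:ℝ) - t)))) ∧ (∀ H Λ : ℝ → ℝ, H = (fun t => ∫ x, ‖Literature.Analysis.FluidPDE.curl (v t) x‖ ^ 2 * K t x) → Λ = (fun t => (0 -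 t) * deriv H t / H t) → (∀ t ∈ Set.Iio (0:ℝ), 0 < H t) ∧ (∀ t ∈ Set.Iio (0:ℝ), Λ t = Λ₀))) ∧ (∃ (ϖ : ℝ → EuclideanSpace ℝ (Fin 3) → ℝ) (G' : ℝ → EuclideanSpace ℝ (Fin 3) → EuclideanSpace ℝ (Fin 3) →L[ℝ] EuclideanSpace ℝ (Fin 3)), Literature.Analysis.FluidPDE.IsSuitableWeakSolutionOn (Literature.Analysis.FluidPDE.slab (EuclideanSpace ℝ (Fin 3)) (Set.Iio 0) isOpen_Iio) ν 0 v ϖ ∧ Literature.Analysis.FluidPDE.HasWeakSpatialGradientOn (Literature.Analysis.FluidPDE.slab (EuclideanSpace ℝ (Fin 3)) (Set.Iio 0) isOpen_Iio) v G' ∧ Literature.Analysis.FluidPDE.typeIBound (Set.Iio (0:ℝ) ×ˢ Set.univ) v ϖ G' < ⊤)) → (¬ ∃ (ν C Λ₀ : ℝ) (v : ℝ → EuclideanSpace ℝ (Fin 3) → EuclideanSpace ℝ (Fin 3)) (q : ℝ → EuclideanSpace ℝ (Fin 3) → ℝ) (K : ℝ → EuclideanSpace ℝ (Fin 3) → ℝ),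 (0 < ν ∧ Literature.Analysis.FluidPDE.IsClassicalNSSolutionOn (Set.Iio 0) ν 0 v q ∧ (∀ t ∈ Set.Iio (0:ℝ), ∀ x, ‖v t x‖ ≤ C / Real.sqrt (-t)) ∧ ContDiffOn ℝ 2 (Function.uncurry K) (Set.Iio (0:ℝ) ×ˢ Set.univ) ∧ (∀ t ∈ Set.Iio (0:ℝ), ∀ x, 0 < K t x) ∧ (∀ t ∈ Set.Iio (0:ℝ), ∀ x, Literature.Analysis.FluidPDE.timeDerivWithin (Set.Iio (0:ℝ)) K t x + fderiv ℝ (K t) x (v t x) + ν * Laplacian.laplacian (K t) x = 0) ∧ (∀ t ∈ Set.Iio (0:ℝ), ∫ x, K t x = 1) ∧ (∀ φ : EuclideanSpace ℝ (Fin 3) → ℝ, Continuous φ → (∃ M : ℝ, ∀ x, |φ x| ≤ M) → Filter.Tendsto (fun t => ∫ x, φ x * K t x) (nhdsWithin (0:ℝ) (Set.Iio (0:ℝ))) (nhds (φ (0 : EuclideanSpace ℝ (Fin 3))))) ∧ (∃ c₁ c₂ C₁ C₂ : ℝ, 0 < c₁ ∧ 0 < c₂ ∧ 0 < C₁ ∧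 0 < C₂ ∧ ∀ t ∈ Set.Iio (0:ℝ), ∀ x, c₁ * ((0:ℝ) - t) ^ (-(3:ℝ) / 2) * Real.exp (-(‖x - (0 : EuclideanSpace ℝ (Fin 3))‖ ^ 2) / (c₂ * ((0:ℝ) - t))) ≤ K t x ∧ K t x ≤ C₁ * ((0:ℝ) - t) ^ (-(3:ℝ) / 2) * Real.exp (-(‖x - (0 : EuclideanSpace ℝ (Fin 3))‖ ^ 2) / (C₂ * ((0:ℝ) - t)))) ∧ (∀ H Λ : ℝ → ℝ, H = (fun t => ∫ x, ‖Literature.Analysis.FluidPDE.curl (v t) x‖ ^ 2 * K t x) → Λ = (fun t => (0 - t) * deriv H t / H t) → (∀ t ∈ Set.Iio (0:ℝ), 0 < H t) ∧ (∀ t ∈ Set.Iio (0:ℝ), Λ t = Λ₀))) ∧ ¬ (∃ (B : ℝ → EuclideanSpace ℝ (Fin 3)) (C_B : ℝ), ContDiffOn ℝ (⊤ : ℕ∞) B (Set.Iio (0:ℝ)) ∧ (∀ t < (0:ℝ), ‖deriv B t‖ ≤ C_B / Real.sqrt (-t)) ∧ Filter.Tendsto B (nhdsWithin (0:ℝ)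 (Set.Iio (0:ℝ))) (nhds (0 : EuclideanSpace ℝ (Fin 3))) ∧ Literature.Analysis.FluidPDE.typeIBound (Set.Iio (0:ℝ) ×ˢ Set.univ) (fun t x => v t (x - B t) + deriv B t) (fun t x => q t (x - B t) - inner ℝ (deriv (deriv B) t) x) (fun t x => fderiv ℝ (v t) (x - B t)) < ⊤)) → Summit.NavierStokesRegularity.NavierStokesRegularity.Theses.AdaptedFrequency.FrequencyRigidity := by
  intro h2' h3
  exact FrequencyRigidity.ScaledEnergySplit.stub_scaledEnergySplitGlue.2
    ⟨FrequencyRigidity.ScaledEnergySplit.stub_frameNormalisation (finiteAB_stub2_of_stub2AB h2'), h3⟩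

end Summit.NavierStokesRegularity.NavierStokesRegularity.Theorems

end
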